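import Literature.AnabelianGeometry.SemiGraphs.TemperedSpecialFibreAdmissibleKernel
import Literature.AnabelianGeometry.SemiGraphs.TemperedResiduallyFiniteHolds
import HarnessLib

/-!
# [SemiAnbd] Cor. 3.11, step (S1): the admissible kernel IS profinitely determined — print's literal
# finite-level shape of (S1) is equivalent to the kernel form with NO residual-finiteness hypothesis

Mochizuki, *Semi-graphs of anabelioids*, Publ. RIMS **42** (2006), §3, Corollary 3.11, proof, manuscript
p. 48 = PRIMS p. 274 [cite: MochizukiSemiAnbd2006, Cor 3.11 p.48]: "the natural quotient
`Δ[□] ↠ π₁^temp(G[□]) ≅ π₁^temp(G^c[□])` — i.e., the quotient determined by the 'admissible quotient' of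
`Δ̂[□]`, in the sense of [Mzk3], §2 — may be characterized as follows: A normal open subgroup of finite index
`Δ'[□] ⊆ Δ[□]` arises from this quotient if and only if …", together with Prop. 3.6 (iii) p. 38 = PRIMS
p. 264: "The full embedding `B(G) ↪ B^temp(G)` induces an injection `π₁^temp(G) ↪ π̂₁(G)` of topological
groups".

PROOF-ONLY complement (abc-iut cell, layer L3, seat abc-iut-L3-t11 gen 5; L3-lead β16 (2) / β23 (1)) of
abc-iut-L3-t9's `TemperedSpecialFibreAdmissibleKernel.lean`, which SPLIT the typed step (S1)
`AdmissibleQuotientCompatible` into the descent CONSTRUCTION and the kernel form (S1a)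
`AdmissibleKernelCompatible`, and proved `KernelCompatible ⟺ FiniteLevelCompatible` (print's LITERAL sentence,
relative to `γ`) UNDER the hypothesis predicate `SpecialFibreData.IsProfinitelyDetermined` ("recorded as a
hypothesis predicate").  That hypothesis is a THEOREM for every special-fibre datum: the admissible kernel is
cut out by the finite-index open normal subgroups containing it because `π₁^temp(G^c)` is residually finite —
[SemiAnbd] Prop. 3.6 (iii), the tree's kernel theorem `ProfiniteSemiGraph.TemperedPiResiduallyFinite_holds`
(`TemperedResiduallyFiniteHolds.lean`), applied at the chart `S.chart` of `G^c` (which satisfies the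
hypotheses of Prop. 3.6: `S.hyp.toProp36Hypotheses`), the separating open normal subgroup of finite index being
pulled back along the continuous surjection `q = S.admissible`.  Consequences, all unconditional:

* `SpecialFibreData.isProfinitelyDetermined` — the discharge;
* `SpecialFibreData.kernelCompatible_iff_finiteLevelCompatible'`,
  `SpecialFibreData.exists_compatible_iff_finiteLevelCompatible` — at one pair of data, a `γ`-compatible
  isomorphism of the tempered fundamental groups of the special fibres exists iff the finite-index open normal
  subgroups "arising from the admissible quotient" correspond under `γ`;
* `SpecialFibreData.ker_le_iff_exists_openNormalSubgroup` — the dictionary behind the typing: "`Δ'` arises from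
  this quotient" (is the preimage of an open normal subgroup of finite index of `π₁^temp(G^c)`) iff `Ker q ≤ Δ'`
  (uses abc-iut-L3-t2's `isOpenMap_admissible`);
* origin level: `admissibleKernelCompatible_iff_finiteLevel`, `admissibleQuotientCompatible_iff_finiteLevel` —
  (S1) ⟺ (S1a) ⟺ print's literal finite-level sentence, the one FACT-policy leaf of (S1) in the shape print
  states it (p. 48 l. −9 … p. 49 l. 5); and the Cor. 3.11 assembly of record re-read through it,
  `corollary_3_11_of_all_cuts_finiteLevel`.

No `def`, no instance, no notation; no statement of the frozen files is altered; (S1a) remains FACT-policy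
(typed, asserted for no origin); nothing here takes a side on [IUTchIII] Cor. 3.12 and nothing asserts or
refutes abc.
-/

noncomputable section

namespace Literature.AnabelianGeometry.SemiGraphs

open ProfiniteSemiGraph Topology

universe u

namespace SpecialFibreData

variable {K : Type u} [Field K] {D : TemperedArithmeticGroup K} (S : SpecialFibreData D)

/-! ### The discharge: the admissible kernel is cut out by its finite levels -/

/-- **`π₁^temp(G^c)` is residually finite** ([SemiAnbd] Prop. 3.6 (iii) p. 38, the tree's kernel theorem
`TemperedPiResiduallyFinite_holds`, at the chart of the special-fibre datum): every `g ≠ 1` of `π₁^temp(G^c)`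
lies outside some open normal subgroup of finite index. [cite: MochizukiSemiAnbd2006, Prop 3.6(iii) p.38] -/
theorem exists_openNormalSubgroup_not_mem (g : S.chart.G) (hg : g ≠ 1) :
    ∃ N : OpenNormalSubgroup S.chart.G, Finite (S.chart.G ⧸ N.toSubgroup) ∧ g ∉ (N : Set S.chart.G) :=
  TemperedPiResiduallyFinite_holds S.Gc S.hyp.toProp36Hypotheses S.chart g hg

/-- The preimage under the admissible quotient `q : Δ ↠ π₁^temp(G^c)` of an open normal subgroup of finite
index is a normal, open subgroup of finite index of `Δ` containing `Ker q` — "a normal open subgroup of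
finite index `Δ'[□] ⊆ Δ[□]` [that] arises from this quotient" (p. 48). [cite: MochizukiSemiAnbd2006, Cor 3.11 p.48] -/
theorem comap_openNormalSubgroup (N : OpenNormalSubgroup S.chart.G)
    (hN : Finite (S.chart.G ⧸ N.toSubgroup)) :
    (N.toSubgroup.comap S.admissible.toMonoidHom).Normal ∧
      IsOpen (N.toSubgroup.comap S.admissible.toMonoidHom : Set D.delta) ∧
      (N.toSubgroup.comap S.admissible.toMonoidHom).FiniteIndex ∧
      S.admissible.toMonoidHom.ker ≤ N.toSubgroup.comap S.admissible.toMonoidHom := by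
  haveI : N.toSubgroup.FiniteIndex := Subgroup.finiteIndex_of_finite_quotient
  refine ⟨Subgroup.Normal.comap inferInstance _, ?_, ?_, ?_⟩
  · rw [Subgroup.coe_comap]
    exact N.toOpenSubgroup.isOpen.preimage S.admissible.continuous
  · refine ⟨?_⟩
    rw [Subgroup.index_comap_of_surjective _ S.admissible_surjective]
    exact Subgroup.FiniteIndex.index_ne_zero
  · intro x hx
    rw [Subgroup.mem_comap, (MonoidHom.mem_ker).1 hx]
    exact one_mem _

/-- **The admissible kernel is profinitely determined** — abc-iut-L3-t9's hypothesis predicate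
`IsProfinitelyDetermined` DISCHARGED for every special-fibre datum: an element of `Δ` lying in every
finite-index open normal subgroup through which `q` factors lies in `Ker q` (print p. 48: "the quotient
determined by the 'admissible quotient' of `Δ̂[□]`" — a quotient of the profinite completion, i.e. determined
by its finite levels), BECAUSE `π₁^temp(G^c)` is residually finite (Prop. 3.6 (iii)): if `q x ≠ 1`, pull a
separating open normal subgroup of finite index back along `q`. [cite: MochizukiSemiAnbd2006, Cor 3.11 p.48] -/
theorem isProfinitelyDetermined : S.IsProfinitelyDetermined := by
  intro x hx
  by_contra h1
  obtain ⟨N, hfin, hnot⟩ := S.exists_openNormalSubgroup_not_mem (S.admissible x) h1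
  obtain ⟨hNn, hNo, hNf, hNk⟩ := S.comap_openNormalSubgroup N hfin
  have hmem : x ∈ N.toSubgroup.comap S.admissible.toMonoidHom := hx _ hNn hNo hNf hNk
  exact hnot (Subgroup.mem_comap.1 hmem)

/-! ### "Arises from the admissible quotient" ⟺ `Ker q ≤ Δ'` (the dictionary behind the typing) -/

/-- **"`Δ'` arises from this quotient" ⟺ `Ker q ≤ Δ'`**: a normal open subgroup of finite index `Δ' ⊆ Δ`
is the preimage under `q : Δ ↠ π₁^temp(G^c)` of an open normal subgroup of finite index of `π₁^temp(G^c)`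
iff it contains `Ker q` (then it is the preimage of its image, which is open because `q` is an OPEN map —
abc-iut-L3-t2's `isOpenMap_admissible` — normal because `q` is surjective, and of finite index).  This is
why abc-iut-L3-t9's `FiniteLevelCompatible` types print's sentence with `Ker q ≤ N`.
[cite: MochizukiSemiAnbd2006, Cor 3.11 p.48] -/
theorem ker_le_iff_exists_openNormalSubgroup (N : Subgroup D.delta) (hN : N.Normal)
    (hNo : IsOpen (N : Set D.delta)) (hNf : N.FiniteIndex) :
    S.admissible.toMonoidHom.ker ≤ N ↔
      ∃ M : OpenNormalSubgroup S.chart.G, Finite (S.chart.G ⧸ M.toSubgroup) ∧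
        N = M.toSubgroup.comap S.admissible.toMonoidHom := by
  constructor
  · intro hle
    have hMn : (N.map S.admissible.toMonoidHom).Normal := hN.map _ S.admissible_surjective
    have hMo : IsOpen (N.map S.admissible.toMonoidHom : Set S.chart.G) := by
      rw [Subgroup.coe_map]
      exact S.isOpenMap_admissible _ hNo
    let M : OpenNormalSubgroup S.chart.G :=
      { toSubgroup := N.map S.admissible.toMonoidHom, isOpen' := hMo, isNormal' := hMn }
    haveI : (N.map S.admissible.toMonoidHom).FiniteIndex := by
      refine ⟨fun h0 => hNf.index_ne_zero ?_⟩
      exact Nat.eq_zero_of_zero_dvd (h0 ▸ Subgroup.index_map_dvd N S.admissible_surjective)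
    refine ⟨M, ?_, ?_⟩
    · exact Subgroup.finite_quotient_of_finiteIndex
    · exact (Subgroup.comap_map_eq_self hle).symm
  · rintro ⟨M, hM, rfl⟩
    exact (S.comap_openNormalSubgroup M hM).2.2.2

/-! ### Kernel compatibility ⟺ print's literal finite-level shape, unconditionally -/

variable {Kα : Type u} [Field Kα] {Kβ : Type u} [Field Kβ]
  {Dα : TemperedArithmeticGroup Kα} {Dβ : TemperedArithmeticGroup Kβ}
  (Sα : SpecialFibreData Dα) (Sβ : SpecialFibreData Dβ)

/-- **`γ(Ker q_α) = Ker q_β` ⟺ the finite-index open normal subgroups arising from the admissible quotients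
correspond under `γ`** — abc-iut-L3-t9's `kernelCompatible_iff_finiteLevelCompatible` with its two
`IsProfinitelyDetermined` hypotheses DISCHARGED (`isProfinitelyDetermined`): print's "A normal open subgroup
of finite index `Δ'[□] ⊆ Δ[□]` arises from this quotient if and only if [a condition compatible with `γ`] …
Thus, we conclude that `γ` induces an isomorphism `π₁^temp(G[α]) ≅ π₁^temp(G[β])`" (pp. 48–49).
[cite: MochizukiSemiAnbd2006, Cor 3.11 pp.48-49] -/
theorem kernelCompatible_iff_finiteLevelCompatible' (γ : Dα.delta ≃ₜ* Dβ.delta) :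
    Sα.KernelCompatible Sβ γ ↔ Sα.FiniteLevelCompatible Sβ γ :=
  kernelCompatible_iff_finiteLevelCompatible Sα.isProfinitelyDetermined Sβ.isProfinitelyDetermined

/-- **A `γ`-compatible isomorphism `π₁^temp(G^c[α]) ⥲ π₁^temp(G^c[β])` EXISTS iff the finite-index open normal
subgroups arising from the admissible quotients correspond under `γ`** (then it is abc-iut-L3-t9's `descend`,
unique by `descended_unique`): the content of (S1) at one pair of data, in print's literal shape.
[cite: MochizukiSemiAnbd2006, Cor 3.11 pp.48-49] -/
theorem exists_compatible_iff_finiteLevelCompatible (γ : Dα.delta ≃ₜ* Dβ.delta) :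
    (∃ φ : Sα.chart.G ≃ₜ* Sβ.chart.G, ∀ x : Dα.delta, φ (Sα.admissible x) = Sβ.admissible (γ x)) ↔
      Sα.FiniteLevelCompatible Sβ γ :=
  (Sα.exists_compatible_iff_kernelCompatible Sβ γ).trans (Sα.kernelCompatible_iff_finiteLevelCompatible' Sβ γ)

/-- From print's finite-level shape, the descended isomorphism. [cite: MochizukiSemiAnbd2006, Cor 3.11 p.49] -/
theorem descend_admissible_of_finiteLevelCompatible (γ : Dα.delta ≃ₜ* Dβ.delta)
    (h : Sα.FiniteLevelCompatible Sβ γ) (x : Dα.delta) :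
    Sα.descend Sβ γ ((Sα.kernelCompatible_iff_finiteLevelCompatible' Sβ γ).2 h) (Sα.admissible x) =
      Sβ.admissible (γ x) :=
  Sα.descend_admissible Sβ γ _ x

end SpecialFibreData

/-! ### Origin level: (S1) ⟺ (S1a) ⟺ print's literal sentence; the Cor. 3.11 assembly re-read -/

section Cor311

variable {Kα : Type u} [Field Kα] {Kβ : Type u} [Field Kβ]

/-- **(S1a) ⟺ print's literal finite-level sentence at the origin hypotheses**, unconditionally: every
`γ : Δ[α] ⥲ Δ[β]` carries `Ker q_α` onto `Ker q_β` (abc-iut-L3-t9's `AdmissibleKernelCompatible`, the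
FACT-policy leaf of (S1)) iff, for every certified pair and every `γ`, "a normal open subgroup of finite index
arises from the admissible quotient [of `α`] iff [its `γ`-image does, for `β`]" (`FiniteLevelCompatible`,
print p. 48 l. −9 … p. 49 l. 5 read relative to `γ`). [cite: MochizukiSemiAnbd2006, Cor 3.11 pp.48-49] -/
theorem admissibleKernelCompatible_iff_finiteLevel (Ωα : SpecialFibreOrigin Kα)
    (Ωβ : SpecialFibreOrigin Kβ) :
    AdmissibleKernelCompatible Ωα Ωβ ↔
      ∀ (Dα : TemperedArithmeticGroup Kα) (Dβ : TemperedArithmeticGroup Kβ)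
        (Sα : SpecialFibreData Dα) (Sβ : SpecialFibreData Dβ),
        Ωα.IsSpecialFibreOf Dα Sα → Ωβ.IsSpecialFibreOf Dβ Sβ →
        ∀ γ : Dα.delta ≃ₜ* Dβ.delta, Sα.FiniteLevelCompatible Sβ γ := by
  constructor
  · intro h Dα Dβ Sα Sβ hα hβ γ
    exact (Sα.kernelCompatible_iff_finiteLevelCompatible' Sβ γ).1 (h Dα Dβ Sα Sβ hα hβ γ)
  · intro h Dα Dβ Sα Sβ hα hβ γ
    exact (Sα.kernelCompatible_iff_finiteLevelCompatible' Sβ γ).2 (h Dα Dβ Sα Sβ hα hβ γ)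

/-- **(S1) ⟺ print's literal finite-level sentence** (fact-list row F-1724 `AdmissibleQuotientCompatible`):
the descent, its bicontinuity (abc-iut-L3-t9) AND the residual finiteness of `π₁^temp(G^c)` (Prop. 3.6 (iii))
are kernel theorems; what remains of (S1) is exactly print's characterisation sentence, relative to `γ`.
[cite: MochizukiSemiAnbd2006, Cor 3.11 pp.48-49] -/
theorem admissibleQuotientCompatible_iff_finiteLevel (Ωα : SpecialFibreOrigin Kα)
    (Ωβ : SpecialFibreOrigin Kβ) :
    AdmissibleQuotientCompatible Ωα Ωβ ↔
      ∀ (Dα : TemperedArithmeticGroup Kα) (Dβ : TemperedArithmeticGroup Kβ)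
        (Sα : SpecialFibreData Dα) (Sβ : SpecialFibreData Dβ),
        Ωα.IsSpecialFibreOf Dα Sα → Ωβ.IsSpecialFibreOf Dβ Sβ →
        ∀ γ : Dα.delta ≃ₜ* Dβ.delta, Sα.FiniteLevelCompatible Sβ γ :=
  (admissibleQuotientCompatible_iff_admissibleKernelCompatible Ωα Ωβ).trans
    (admissibleKernelCompatible_iff_finiteLevel Ωα Ωβ)

/-- **[SemiAnbd] Cor. 3.11 with all three cuts applied, (S1) in print's LITERAL finite-level shape**:
`Cor311 ⇐ finiteness ∧ [finite-index open normal subgroups arising from the admissible quotients correspond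
under every γ] ∧ (S2a)×2 ∧ (S2b) ∧ CuspBranchesPreserved` — abc-iut-L3-t9's `corollary_3_11_of_all_cuts` (on
abc-iut-L3-t11 gen 4's `corollary_3_11_of_cuts`, abc-iut-w4-d083's cusp extension and the (S2) inertia cut) with
(S1a) supplied from the finite-level sentence by `admissibleKernelCompatible_iff_finiteLevel`.  Every
hypothesis is a quoted sentence of the printed proof typed over the origin hypotheses and asserted for no
origin. [cite: MochizukiSemiAnbd2006, Cor 3.11 pp.45-49] -/
theorem corollary_3_11_of_all_cuts_finiteLevel (pα pβ : ℕ) [Fact pα.Prime] [Fact pβ.Prime]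
    [Algebra ℚ_[pα] Kα] [FiniteDimensional ℚ_[pα] Kα] [Algebra ℚ_[pβ] Kβ] [FiniteDimensional ℚ_[pβ] Kβ]
    (Ωα : SpecialFibreOrigin Kα) (Ωβ : SpecialFibreOrigin Kβ) (Sig : Set ℕ)
    (hfinα : ∀ (D : TemperedArithmeticGroup Kα) (Sp : SpecialFibreData D), Ωα.IsSpecialFibreOf D Sp →
      Finite Sp.Gc.graph.Vertex ∧ Finite Sp.Gc.graph.Edge)
    (hfinβ : ∀ (D : TemperedArithmeticGroup Kβ) (Sp : SpecialFibreData D), Ωβ.IsSpecialFibreOf D Sp →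
      Finite Sp.Gc.graph.Vertex ∧ Finite Sp.Gc.graph.Edge)
    (hS1 : ∀ (Dα : TemperedArithmeticGroup Kα) (Dβ : TemperedArithmeticGroup Kβ)
        (Sα : SpecialFibreData Dα) (Sβ : SpecialFibreData Dβ),
        Ωα.IsSpecialFibreOf Dα Sα → Ωβ.IsSpecialFibreOf Dβ Sβ →
        ∀ γ : Dα.delta ≃ₜ* Dβ.delta, Sα.FiniteLevelCompatible Sβ γ)
    (hS2a : InertiaOrdersPrimePow Sig pα Ωα) (hS2a' : InertiaOrdersPrimePow Sig pβ Ωβ)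
    (hS2b : HasNontrivialInertia Sig Ωα) (hCB : CuspBranchesPreserved Ωα Ωβ) : Cor311 pα pβ Ωα Ωβ :=
  corollary_3_11_of_all_cuts pα pβ Ωα Ωβ Sig hfinα hfinβ
    ((admissibleKernelCompatible_iff_finiteLevel Ωα Ωβ).2 hS1) hS2a hS2a' hS2b hCB

end Cor311

end Literature.AnabelianGeometry.SemiGraphs

end
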